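import Mathlib.Analysis.SpecialFunctions.Pow.Real
import Mathlib.Analysis.SpecialFunctions.Sqrt
import Mathlib.Analysis.Convex.SpecificFunctions.Basic

/-!
# `PolycrystalWulffBound`, lane P: the arithmetic of the NEAR-TWIN REDUCTION (generic pairs close to the Σ3 twin)
# (helper for crux `stmt-Ventures-19482`; poly-p2 g21, memo `HOME/poly-p2/C1-COST-g21.md` §7)

Route `StickyWulffConstant` of the venture `Summits/Ventures/Crystal3D`.  The certified «∀R» column of lane P covers
the cubic misorientation cell by BOXES on which `D_F(R) < 1` (BOX1-g20, C1-COST-g21).  The one place a box count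
diverges is the neighbourhood of the TWIN vertex Σ3 (the crux's only co-axial misorientation): there the generic
two-grain inequality at wall constant `c ≥ 1` follows instead from the CO-AXIAL twin inequality (lane P's named fact
`TwoGrainTwinInequality`, charge `½`) by an elementary two-case argument (C1-COST-g21 §7.1).  This file proves the
REAL ARITHMETIC of that argument, in the style of `…DichotomyArith` / `…DominantArith`; the geometric inputs
(facet calculus: `E = ∫_{F₁} h_W + ∫_{F₂} h_{RW} + c·H²(J)`, `Per_K(S) ≥ √3·H²(∂*S)`, the support-function gap
`|h_{RW} − h_{R*W}| ≤ ε`) are hypotheses here and are the successor's kernel item.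

* `rpow_two_thirds_add_le`: for `0 ≤ b ≤ a`, `(a + b)^{2/3} ≤ a^{2/3} + (2/3)·b^{2/3}` (Bernoulli for the exponent
  `2/3` plus `b/a ≤ 1`) — splitting off the smaller grain costs at most two thirds of its own Wulff bound;
* `nearTwin_arith`: with `w(v) = κ·v^{2/3}` and reals `E` (energy of the generic pair at `c ≥ 1`), `Es` (energy of
  the same sets for the twin pair at charge `½`), `P₁, P₂` (the two anisotropic perimeters), `J` (interface area),
  `F` (exposed area of the smaller grain), `ε` (support gap): IF `Es + J/2 − εF ≤ E` (comparison of the two laws),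
  `w(v₁+v₂) ≤ Es` (twin inequality), `P₁ + P₂ − (2√5 − 1)J ≤ E` (separation), `w(v_i) ≤ P_i` (Wulff per grain),
  `√3·F ≤ P₂` (inradius √3), `0 ≤ v₂ ≤ v₁` and `2(2√5 − 1)·ε ≤ √3/3` (i.e. `ε ≤ 0.0831`, every misorientation within
  2.13° of the twin), THEN `w(v₁ + v₂) ≤ E`.  (The paper version reaches `ε ≤ 0.1029` / 2.64° with the sharp
  concavity constant `2 − 2^{2/3}` in place of `2/3`.)

WHAT THIS IS NOT: the geometric reduction itself (facet sums, De Giorgi perimeters) — only its arithmetic; nothing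
about the crux; rung F-C1 not moved.
-/

noncomputable section

namespace Summit.Ventures.Crystal3D.Theorems

/-- **Two-thirds splitting bound.**  For `0 ≤ b ≤ a`: `(a + b)^{2/3} ≤ a^{2/3} + (2/3)·b^{2/3}`.
(Bernoulli: `(1 + s)^{2/3} ≤ 1 + (2/3)s` with `s = b/a`, times `a^{2/3}`, and `a^{-1/3} b ≤ b^{2/3}` from `b ≤ a`.) -/
theorem rpow_two_thirds_add_le {a b : ℝ} (hb : 0 ≤ b) (hba : b ≤ a) :
    (a + b) ^ ((2 : ℝ) / 3) ≤ a ^ ((2 : ℝ) / 3) + 2 / 3 * b ^ ((2 : ℝ) / 3) := by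
  rcases hb.eq_or_lt with hb0 | hbpos
  · -- `b = 0`
    rw [← hb0, add_zero, Real.zero_rpow (by norm_num), mul_zero, add_zero]
  have hapos : 0 < a := lt_of_lt_of_le hbpos hba
  -- Bernoulli with `s = b / a ≥ 0 ≥ -1`, exponent `2/3 ∈ [0,1]`
  have hs : -1 ≤ b / a := le_trans (by norm_num) (div_nonneg hb hapos.le)
  have hB := rpow_one_add_le_one_add_mul_self hs (p := (2 : ℝ) / 3) (by norm_num) (by norm_num)
  -- `(a + b)^{2/3} = a^{2/3} (1 + b/a)^{2/3}`
  have hsplit : (a + b) ^ ((2 : ℝ) / 3) = a ^ ((2 : ℝ) / 3) * (1 + b / a) ^ ((2 : ℝ) / 3) := by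
    rw [← Real.mul_rpow hapos.le (by positivity)]
    congr 1
    field_simp
  -- `a^{2/3} · (b/a) = a^{-1/3} b ≤ b^{2/3}`
  have hkey : a ^ ((2 : ℝ) / 3) * (b / a) ≤ b ^ ((2 : ℝ) / 3) := by
    have h1 : a ^ ((2 : ℝ) / 3) * (b / a) = b * a ^ (-(1 : ℝ) / 3) := by
      have h23 : a ^ ((2 : ℝ) / 3) = a * a ^ (-(1 : ℝ) / 3) := by
        rw [show a * a ^ (-(1 : ℝ) / 3) = a ^ (1 : ℝ) * a ^ (-(1 : ℝ) / 3) by rw [Real.rpow_one],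
          ← Real.rpow_add hapos]
        norm_num
      rw [h23]
      field_simp
    have h2 : a ^ (-(1 : ℝ) / 3) ≤ b ^ (-(1 : ℝ) / 3) :=
      Real.rpow_le_rpow_of_nonpos hbpos hba (by norm_num)
    have h3 : b * b ^ (-(1 : ℝ) / 3) = b ^ ((2 : ℝ) / 3) := by
      rw [show b * b ^ (-(1 : ℝ) / 3) = b ^ (1 : ℝ) * b ^ (-(1 : ℝ) / 3) by rw [Real.rpow_one],
        ← Real.rpow_add hbpos]; norm_num
    calc a ^ ((2 : ℝ) / 3) * (b / a) = b * a ^ (-(1 : ℝ) / 3) := h1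
      _ ≤ b * b ^ (-(1 : ℝ) / 3) := by gcongr
      _ = b ^ ((2 : ℝ) / 3) := h3
  have ha23 : 0 ≤ a ^ ((2 : ℝ) / 3) := Real.rpow_nonneg hapos.le _
  calc (a + b) ^ ((2 : ℝ) / 3) = a ^ ((2 : ℝ) / 3) * (1 + b / a) ^ ((2 : ℝ) / 3) := hsplit
    _ ≤ a ^ ((2 : ℝ) / 3) * (1 + 2 / 3 * (b / a)) := by gcongr
    _ = a ^ ((2 : ℝ) / 3) + 2 / 3 * (a ^ ((2 : ℝ) / 3) * (b / a)) := by ring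
    _ ≤ a ^ ((2 : ℝ) / 3) + 2 / 3 * b ^ ((2 : ℝ) / 3) := by gcongr

/-- **Near-twin reduction, arithmetic core** (C1-COST-g21 §7.1).  See the module docstring for the meaning of the
reals.  Case 1 (`εF ≤ J/2`): the comparison `h1` and the twin inequality `h2` give the bound.  Case 2 (`J < 2εF`):
`(2√5 − 1)J ≤ 2(2√5 − 1)ε·F ≤ 2(2√5 − 1)ε/√3 · P₂ ≤ P₂/3`, so `E ≥ P₁ + (2/3)P₂ ≥ κ(v₁^{2/3} + (2/3)v₂^{2/3}) ≥
κ(v₁ + v₂)^{2/3}` by `rpow_two_thirds_add_le`. -/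
theorem nearTwin_arith {E Es P₁ P₂ J F v₁ v₂ ε κ : ℝ} (hκ : 0 ≤ κ) (hv₂ : 0 ≤ v₂) (h21 : v₂ ≤ v₁)
    (hεmax : 2 * (2 * Real.sqrt 5 - 1) * ε ≤ Real.sqrt 3 / 3) (hF : 0 ≤ F)
    (h1 : Es + J / 2 - ε * F ≤ E) (h2 : κ * (v₁ + v₂) ^ ((2 : ℝ) / 3) ≤ Es)
    (h3 : P₁ + P₂ - (2 * Real.sqrt 5 - 1) * J ≤ E)
    (h4 : κ * v₁ ^ ((2 : ℝ) / 3) ≤ P₁) (h5 : κ * v₂ ^ ((2 : ℝ) / 3) ≤ P₂) (h6 : Real.sqrt 3 * F ≤ P₂) :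
    κ * (v₁ + v₂) ^ ((2 : ℝ) / 3) ≤ E := by
  have h3pos : 0 < Real.sqrt 3 := Real.sqrt_pos.2 (by norm_num)
  have h5ge : (1 : ℝ) ≤ 2 * Real.sqrt 5 - 1 := by
    have : (1 : ℝ) ≤ Real.sqrt 5 := by
      rw [show (1 : ℝ) = Real.sqrt 1 by rw [Real.sqrt_one]]
      exact Real.sqrt_le_sqrt (by norm_num)
    linarith
  by_cases hcase : ε * F ≤ J / 2
  · -- Case 1: the twin inequality pays
    linarith
  · -- Case 2: the interface is small against the exposed area of the smaller grain
    push Not at hcase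
    have hJ : J < 2 * ε * F := by linarith
    have hP₂ : 0 ≤ P₂ := le_trans (mul_nonneg h3pos.le hF) h6
    -- `(2√5 − 1) J ≤ (2√5 − 1) · 2εF`
    have hA : (2 * Real.sqrt 5 - 1) * J ≤ (2 * Real.sqrt 5 - 1) * (2 * ε * F) :=
      mul_le_mul_of_nonneg_left hJ.le (le_trans zero_le_one h5ge)
    -- `(2√5 − 1)·2ε·F ≤ (√3/3)·F ≤ P₂/3`
    have hB : (2 * Real.sqrt 5 - 1) * (2 * ε * F) ≤ Real.sqrt 3 / 3 * F := by
      have : (2 * Real.sqrt 5 - 1) * (2 * ε * F) = (2 * (2 * Real.sqrt 5 - 1) * ε) * F := by ring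
      rw [this]
      exact mul_le_mul_of_nonneg_right hεmax hF
    have hC : Real.sqrt 3 / 3 * F ≤ P₂ / 3 := by
      have : Real.sqrt 3 / 3 * F = (Real.sqrt 3 * F) / 3 := by ring
      rw [this]
      exact div_le_div_of_nonneg_right h6 (by norm_num)
    have hE : P₁ + 2 / 3 * P₂ ≤ E := by linarith
    have hsplit := rpow_two_thirds_add_le hv₂ h21
    calc κ * (v₁ + v₂) ^ ((2 : ℝ) / 3) ≤ κ * (v₁ ^ ((2 : ℝ) / 3) + 2 / 3 * v₂ ^ ((2 : ℝ) / 3)) :=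
          mul_le_mul_of_nonneg_left hsplit hκ
      _ = κ * v₁ ^ ((2 : ℝ) / 3) + 2 / 3 * (κ * v₂ ^ ((2 : ℝ) / 3)) := by ring
      _ ≤ P₁ + 2 / 3 * P₂ := by gcongr
      _ ≤ E := hE

end Summit.Ventures.Crystal3D.Theorems

end
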